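/-
Copyright (c) 2026. All rights reserved.
Released under Apache 2.0 license as described in the file LICENSE.
Authors: abc-iut cell — seat abc-iut-w5-d053 (gen 3; L4-lead row «Cor36-K-STEP3», adapter for abc-iut-L4-t5's
row «Cor36-CROSS»).
-/
import Literature.AnabelianGeometry.AbsoluteAnabelian.AbsTopIII.FrobeniusPictureMLFLogGlueFamily

/-!
# [AbsTopIII] Cor 3.6 (iii): the cross-term hypothesis of the master family FROM ITS IMAGE FORM (adapter)

S. Mochizuki, *Topics in Absolute Anabelian Geometry III*, Cor. 3.6 (iii) pp. 80–81 (`MochizukiAbsTopIII2015`).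
PROOF-ONLY file (no definition).  `FrobeniusPictureMLFLogGlueFamily.lean` (abc-iut-w5-d053, p431675) reduces the
cores clause `LogObsCompatCoresStmt` to ONE hypothesis `hcross` — the whisker law of the glued homotopies for a
glued pair into `𝒩` post-whiskered into a core vertex, quantified over ALL such `𝒟`-pairs.  abc-iut-L4-t5's
cross-term file («Cor36-CROSS») proves the identity in IMAGE FORM — for `embLog`-images of `𝒟_{≤3}`-paths
`r ∘ p`, `r ∘ q` with `(p, q) ∈ E_{H₃}`, the glued homotopy of `(p, q)` replaced by the pushed-forward `𝔖_log`
homotopy `pushLogη H₃ hh` (stated on `coresFamily` / `pushLogη`, independent of p431675).  This adapter closes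
the gap: `glueCross_of_mapPath : image form → hcross` (endpoints cased, paths rewritten as images via
`embLog_mapPath_liftLogPath`, then `glueη_mapPath`), and `logObsCompatCoresStmt_of_imageCross : IsLogObservableFamily
H₃ → image form → Δ.LogObsCompatCoresStmt`.  Nothing of the cross term is proved here; no claim of the paper is
asserted; nothing bears on [IUTchIII] Cor. 3.12; typed ≠ discharged.
-/

namespace Literature.AnabelianGeometry.AbsoluteAnabelian

open _root_.CategoryTheory _root_.Quiver

universe u

namespace LogFrobeniusData

open DiagramOfCategories

variable (Δ : LogFrobeniusData.{u})

/-! ### §4 (abc-iut-w5-d053): the cross-term binder from its IMAGE form (adapter for «Cor36-CROSS») -/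

/-- `eqToHom` bookkeeping: replacing the middle 2-cell of a whiskered sandwich along an equality (generic;
applied by `exact`). [folklore] -/
private theorem whisker_sandwich_congr {A B C C' : Type*} [Category A] [Category B] [Category C] [Category C']
    (F : A ⥤ B) {G H : B ⥤ C} {η η' : G ⟶ H} (hη : η = η') (I : C ⥤ C') {X Y : A ⥤ C'}
    (e₁ : X = F ⋙ (G ⋙ I)) (e₂ : F ⋙ (H ⋙ I) = Y) {L : X ⟶ Y}
    (hL : L = eqToHom e₁ ≫ Functor.whiskerLeft F (Functor.whiskerRight η' I) ≫ eqToHom e₂) :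
    L = eqToHom e₁ ≫ Functor.whiskerLeft F (Functor.whiskerRight η I) ≫ eqToHom e₂ := by
  subst hη
  exact hL

/-- **Adapter for the cross term.**  The hypothesis `hcross` of `glueη_whisker` / `glueFamily` /
`logObsCompatCoresStmt_of_glueCross` (a statement about ALL glued pairs into `𝒩`, pre-whiskered by any `r₁` and
post-whiskered by any `r₂ : 𝒩 → d` into a core vertex) FOLLOWS from its IMAGE FORM: the same identity for
`embLog`-images of `𝒟_{≤3}`-paths `r ∘ p`, `r ∘ q` with `(p, q) ∈ E_{H₃}`, the glued homotopy of `(p, q)` replaced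
by the pushed-forward `𝔖_log` homotopy `pushLogη H₃ hh` — the shape in which abc-iut-L4-t5's cross-term file
states it (on `coresFamily` / `pushLogη`, without this file).  Proof: endpoints cased, paths rewritten as images
(`embLog_mapPath_liftLogPath`), `glueη_mapPath`. [cite: MochizukiAbsTopIII2015, Corollary 3.6 (iii) p.81] -/
theorem glueCross_of_mapPath (H₃ : Δ.sub3.HomotopyFamily) (hgen : HomotopyFamily.IsGeneratedBy _ H₃ Δ.LogGen)
    (himg : ∀ ⦃c₀ a₀ : logObsShape.{u}.Vertex⦄ (r : Path c₀ a₀) (p q : Path a₀ lvObs) (hh : H₃.E p q)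
      ⦃d : LFVertex⦄ (r₂ : Path LFVertex.third d), coreVertices d →
      ∀ h' : Δ.GlueE ((embLog.mapPath r).comp ((embLog.mapPath p).comp r₂))
          ((embLog.mapPath r).comp ((embLog.mapPath q).comp r₂)),
        Δ.glueη H₃ hgen h' =
          eqToHom (by rw [pathFunctor_comp, pathFunctor_comp]) ≫
            Functor.whiskerLeft (Δ.diagram.pathFunctor (embLog.mapPath r))
              (Functor.whiskerRight (Δ.pushLogη H₃ hh) (Δ.diagram.pathFunctor r₂)) ≫
            eqToHom (by rw [pathFunctor_comp, pathFunctor_comp]))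
    ⦃a c d : LFVertex⦄ ⦃P Q : Path a LFVertex.third⦄ (h : Δ.GlueE P Q) (r₁ : Path c a)
    (r₂ : Path LFVertex.third d) (hd : coreVertices d) :
    Δ.glueη H₃ hgen (Δ.isSaturated_glueE.precomp (Δ.isSaturated_glueE.postcomp h r₂) r₁) =
      eqToHom (by rw [pathFunctor_comp, pathFunctor_comp]) ≫
        Functor.whiskerLeft (Δ.diagram.pathFunctor r₁)
          (Functor.whiskerRight (Δ.glueη H₃ hgen h) (Δ.diagram.pathFunctor r₂)) ≫
        eqToHom (by rw [pathFunctor_comp, pathFunctor_comp]) := by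
  rcases a with n | _ | _ | _ | _ | _
  · -- a = row1
    rcases c with m | _ | _ | _ | _ | _
    · obtain ⟨p, rfl⟩ : ∃ p : Path (lvRow1 n) lvObs, embLog.mapPath p = P :=
        ⟨_, eq_of_heq (embLog_mapPath_liftLogPath.{u} P le_rfl)⟩
      obtain ⟨q, rfl⟩ : ∃ q : Path (lvRow1 n) lvObs, embLog.mapPath q = Q :=
        ⟨_, eq_of_heq (embLog_mapPath_liftLogPath.{u} Q le_rfl)⟩
      obtain ⟨r, rfl⟩ : ∃ r : Path (lvRow1 m) (lvRow1 n), embLog.mapPath r = r₁ :=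
        ⟨_, eq_of_heq (embLog_mapPath_liftLogPath.{u} r₁ (by simp [LFVertex.row]))⟩
      exact whisker_sandwich_congr _ (Δ.glueη_mapPath H₃ hgen p q h (Δ.logE_of_glueE_mapPath H₃ hgen p q h))
        _ _ _ (himg r p q _ r₂ hd _)
    · exact absurd (LFVertex.row_le_of_path r₁) (by simp [LFVertex.row])
    · exact absurd (LFVertex.row_le_of_path r₁) (by simp [LFVertex.row])
    · exact absurd (LFVertex.row_le_of_path r₁) (by simp [LFVertex.row])
    · exact absurd (LFVertex.row_le_of_path r₁) (by simp [LFVertex.row])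
    · exact absurd (LFVertex.row_le_of_path r₁) (by simp [LFVertex.row])
  · -- a = nexus
    rcases c with m | _ | _ | _ | _ | _
    · obtain ⟨p, rfl⟩ : ∃ p : Path (lvNexus) lvObs, embLog.mapPath p = P :=
        ⟨_, eq_of_heq (embLog_mapPath_liftLogPath.{u} P le_rfl)⟩
      obtain ⟨q, rfl⟩ : ∃ q : Path (lvNexus) lvObs, embLog.mapPath q = Q :=
        ⟨_, eq_of_heq (embLog_mapPath_liftLogPath.{u} Q le_rfl)⟩
      obtain ⟨r, rfl⟩ : ∃ r : Path (lvRow1 m) (lvNexus), embLog.mapPath r = r₁ :=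
        ⟨_, eq_of_heq (embLog_mapPath_liftLogPath.{u} r₁ (by simp [LFVertex.row]))⟩
      exact whisker_sandwich_congr _ (Δ.glueη_mapPath H₃ hgen p q h (Δ.logE_of_glueE_mapPath H₃ hgen p q h))
        _ _ _ (himg r p q _ r₂ hd _)
    · obtain ⟨p, rfl⟩ : ∃ p : Path (lvNexus) lvObs, embLog.mapPath p = P :=
        ⟨_, eq_of_heq (embLog_mapPath_liftLogPath.{u} P le_rfl)⟩
      obtain ⟨q, rfl⟩ : ∃ q : Path (lvNexus) lvObs, embLog.mapPath q = Q :=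
        ⟨_, eq_of_heq (embLog_mapPath_liftLogPath.{u} Q le_rfl)⟩
      obtain ⟨r, rfl⟩ : ∃ r : Path (lvNexus) (lvNexus), embLog.mapPath r = r₁ :=
        ⟨_, eq_of_heq (embLog_mapPath_liftLogPath.{u} r₁ (by simp [LFVertex.row]))⟩
      exact whisker_sandwich_congr _ (Δ.glueη_mapPath H₃ hgen p q h (Δ.logE_of_glueE_mapPath H₃ hgen p q h))
        _ _ _ (himg r p q _ r₂ hd _)
    · exact absurd (LFVertex.row_le_of_path r₁) (by simp [LFVertex.row])
    · exact absurd (LFVertex.row_le_of_path r₁) (by simp [LFVertex.row])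
    · exact absurd (LFVertex.row_le_of_path r₁) (by simp [LFVertex.row])
    · exact absurd (LFVertex.row_le_of_path r₁) (by simp [LFVertex.row])
  · -- a = third
    rcases c with m | _ | _ | _ | _ | _
    · obtain ⟨p, rfl⟩ : ∃ p : Path (lvObs) lvObs, embLog.mapPath p = P :=
        ⟨_, eq_of_heq (embLog_mapPath_liftLogPath.{u} P le_rfl)⟩
      obtain ⟨q, rfl⟩ : ∃ q : Path (lvObs) lvObs, embLog.mapPath q = Q :=
        ⟨_, eq_of_heq (embLog_mapPath_liftLogPath.{u} Q le_rfl)⟩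
      obtain ⟨r, rfl⟩ : ∃ r : Path (lvRow1 m) (lvObs), embLog.mapPath r = r₁ :=
        ⟨_, eq_of_heq (embLog_mapPath_liftLogPath.{u} r₁ le_rfl)⟩
      exact whisker_sandwich_congr _ (Δ.glueη_mapPath H₃ hgen p q h (Δ.logE_of_glueE_mapPath H₃ hgen p q h))
        _ _ _ (himg r p q _ r₂ hd _)
    · obtain ⟨p, rfl⟩ : ∃ p : Path (lvObs) lvObs, embLog.mapPath p = P :=
        ⟨_, eq_of_heq (embLog_mapPath_liftLogPath.{u} P le_rfl)⟩
      obtain ⟨q, rfl⟩ : ∃ q : Path (lvObs) lvObs, embLog.mapPath q = Q :=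
        ⟨_, eq_of_heq (embLog_mapPath_liftLogPath.{u} Q le_rfl)⟩
      obtain ⟨r, rfl⟩ : ∃ r : Path (lvNexus) (lvObs), embLog.mapPath r = r₁ :=
        ⟨_, eq_of_heq (embLog_mapPath_liftLogPath.{u} r₁ le_rfl)⟩
      exact whisker_sandwich_congr _ (Δ.glueη_mapPath H₃ hgen p q h (Δ.logE_of_glueE_mapPath H₃ hgen p q h))
        _ _ _ (himg r p q _ r₂ hd _)
    · obtain ⟨p, rfl⟩ : ∃ p : Path (lvObs) lvObs, embLog.mapPath p = P :=
        ⟨_, eq_of_heq (embLog_mapPath_liftLogPath.{u} P le_rfl)⟩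
      obtain ⟨q, rfl⟩ : ∃ q : Path (lvObs) lvObs, embLog.mapPath q = Q :=
        ⟨_, eq_of_heq (embLog_mapPath_liftLogPath.{u} Q le_rfl)⟩
      obtain ⟨r, rfl⟩ : ∃ r : Path (lvObs) (lvObs), embLog.mapPath r = r₁ :=
        ⟨_, eq_of_heq (embLog_mapPath_liftLogPath.{u} r₁ le_rfl)⟩
      exact whisker_sandwich_congr _ (Δ.glueη_mapPath H₃ hgen p q h (Δ.logE_of_glueE_mapPath H₃ hgen p q h))
        _ _ _ (himg r p q _ r₂ hd _)
    · exact absurd (LFVertex.row_le_of_path r₁) (by simp [LFVertex.row])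
    · exact absurd (LFVertex.row_le_of_path r₁) (by simp [LFVertex.row])
    · exact absurd (LFVertex.row_le_of_path r₁) (by simp [LFVertex.row])
  · exact (false_of_path_to_third (by decide) P).elim
  · exact (false_of_path_to_third (by decide) P).elim
  · exact (false_of_path_to_third (by decide) P).elim

variable {Δ} in
/-- **[AbsTopIII] Cor 3.6 (iii), cores clause, from the IMAGE FORM of the cross-term identity** (the shape
abc-iut-L4-t5's «Cor36-CROSS» file proves from `IotaOverGaloisStmt`): `logObsCompatCoresStmt_of_glueCross` fed
through the adapter `glueCross_of_mapPath`. [cite: MochizukiAbsTopIII2015, Corollary 3.6 (iii) p.80] -/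
theorem logObsCompatCoresStmt_of_imageCross {H₃ : Δ.sub3.HomotopyFamily} (hH₃ : Δ.IsLogObservableFamily H₃)
    (himg : ∀ ⦃c₀ a₀ : logObsShape.{u}.Vertex⦄ (r : Path c₀ a₀) (p q : Path a₀ lvObs) (hh : H₃.E p q)
      ⦃d : LFVertex⦄ (r₂ : Path LFVertex.third d), coreVertices d →
      ∀ h' : Δ.GlueE ((embLog.mapPath r).comp ((embLog.mapPath p).comp r₂))
          ((embLog.mapPath r).comp ((embLog.mapPath q).comp r₂)),
        Δ.glueη H₃ hH₃.1 h' =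
          eqToHom (by rw [pathFunctor_comp, pathFunctor_comp]) ≫
            Functor.whiskerLeft (Δ.diagram.pathFunctor (embLog.mapPath r))
              (Functor.whiskerRight (Δ.pushLogη H₃ hh) (Δ.diagram.pathFunctor r₂)) ≫
            eqToHom (by rw [pathFunctor_comp, pathFunctor_comp])) :
    Δ.LogObsCompatCoresStmt :=
  logObsCompatCoresStmt_of_glueCross hH₃ (Δ.glueCross_of_mapPath H₃ hH₃.1 himg)

end LogFrobeniusData

end Literature.AnabelianGeometry.AbsoluteAnabelian
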